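import Literature.IUT.HodgeArakelov.RealifiedDataDegreeTorsor
import HarnessLib

/-!
# [IUTchII] Cor 4.5 (ii) (final display) and Cor 4.10 (v): the functor `‡D^⊢ ↦ (D^⊩(‡D^⊢), Prime(D^⊩(‡D^⊢)) ⥲ V̲, {‡ρ_{D^⊩,v}}_v)`
# and «the full poly-isomorphism induces AN isomorphism of collections of data»

abc-iut cell (D-0067 wave 4), seat abc-iut-w4-d009 (gen 2); part 2 of the «prove in-cone at the model» disposition of GAP row
G-w4d009-1, over `RealifiedDataDegreeTorsor.lean` (the category `RlfData V`). S. Mochizuki, *Inter-universal Teichmüller theory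
II*, kurims manuscript (Dec 2020) [paper:url-5036b4059555], read on the page (own render): Cor 4.5 (ii) p.132 l.19–37 «Finally,
there is a functorial algorithm in the `D^⊢`-prime-strip `‡D^⊢` for constructing a Frobenioid `D^⊩(‡D^⊢)` [cf. the Frobenioid
“`D^⊩_mod`” of [IUTchI], Example 3.5, (iii)] isomorphic to the Frobenioid “`C^⊩_mod`” of [IUTchI], Example 3.5, (i), equipped
with a bijection `Prime(D^⊩(‡D^⊢)) ⥲ V̲` […] and, for each `v ∈ V̲`, an isomorphism of topological monoids
`‡ρ_{D^⊩,v} : Φ_{D^⊩(‡D^⊢),v} ⥲ R_{≥0}(‡D^⊢)_v`»; Cor 4.10 (v) p.160 l.77 – p.161 l.6 «The full poly-isomorphism `†D^⊢_△ ⥲ ‡D^⊢_△` of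
(iv) induces [cf. Corollary 4.5, (ii)] an isomorphism of collections of data […] Moreover, this isomorphism of collections of
data is compatible, relative to the Θ^{×μ}- and Θ^{×μ}_{gau}-links of (iii), with the `R_{>0}`-orbits of the isomorphisms of
collections of data […] obtained by applying the functorial algorithm discussed in the final portion of Corollary 4.6, (ii).»
([IUTchIII] Thm 1.5 (v), kurims May 2020 [paper:url-4b091feeb646] p.50 l.−6 – p.51 l.9, repeats both sentences along the
log-theta-lattice; [IUTchI] Ex 3.5 (iii) p.86: «`ρ^D_v : Φ_{D^⊩_mod,v} ⥲ (R^⊢_{≥0})_v` by assigning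
`log^D_mod(p_v) ↦ (1/[K_v:(F_mod)_v]) log^D_Φ(p_v)`».) Claim key `Mochizuki2012` DISPUTED (D-0012).

THE FUNCTOR `realifiedD`, over ANY category `𝒟` of `D^⊢`-prime-strips (abc-iut-L5-t4/L6-t7 `MultKit.DMono`, the frame field
`StripFrame.Dv` of abc-iut-L6-t3, …): INPUT the object part — the pointed lines `R_{≥0}(X)_v ∋ log^{X}(p_v)` of each strip `X`
([IUTchII] Prop 4.1 (ii)/4.3 (ii)/Rmk 4.2.1 (i) ⟵ [AbsTopIII] Prop 5.8 (iii)/(vi), owner abc-iut-L4-t3) and the scalars of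
`ρ_{D^⊩,v}` (abc-iut-L5-t2 `InitialThetaData.rhoDScalar`·`logDPhiCoord`, depending on `v` ONLY). The MORPHISM part is FORCED: an
isomorphism of `D^⊢`-prime-strips induces on `R_{≥0}(−)_v` an isomorphism carrying Frobenius element to Frobenius element (these are
part of the functorially reconstructed data), and between two rank-one pointed lines there is EXACTLY ONE such linear isomorphism
(`RLine.eq_frobIso_of_map_frob`) — so `D^⊩(α)` is the Frobenius-preserving morphism of degree `1` whatever `α` is; the functor laws
hold by that uniqueness. PROVED: Cor 4.10 (v) first sentence — parallel isomorphisms induce the SAME isomorphism of data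
(`realifiedD_mapIso_eq`), `D^⊩(−)` kills every automorphism (`realifiedD_mapIso_eq_refl` — the shape GAP row G-w4d009-1 asks of a real
`BiCoricData.realified`), the full poly-isomorphism induces a SINGLE isomorphism (`map_polyIso_eq_single`) — while the target category
is NOT rigid (`RlfData.dilate_ne_id`); second sentence — the transported `ℝ_{>0}`-orbits are whole hom-sets (`orbit_comp_realifiedD`).
Consumer: [IUTchIII] Thm 1.5 (v) (`Literature.IUT.LogThetaLattice.BiCoricData.Thm15vSingleIso`, FACT-LIST F-2066/F-2067) through
`BiCoricData.thm15vSingleIso_of_faithful_coordinates` (p412780) — bridge by the G-w4d009-1 holder abc-iut-w4-d005. HONEST FRAMING: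
a definition in disclosed coordinates and its elementary consequences; nothing asserts a disputed claim; no side on [IUTchIII] Cor 3.12.
-/

open CategoryTheory

universe u w v₁ u₁

namespace Literature.IUT.HodgeArakelov

open Literature.AnabelianGeometry.AbsoluteAnabelian Literature.IUT.HodgeTheaters

/-! ### §3. The functor `‡D^⊢ ↦ (D^⊩(‡D^⊢), Prime(D^⊩(‡D^⊢)) ⥲ V̲, {‡ρ_{D^⊩,v}}_v)` and Cor 4.10 (v) -/

section RealifiedD

variable {V : Type u} {𝒟 : Type u₁} [Category.{v₁} 𝒟]
  (line : 𝒟 → V → RLine.{w}) (c : V → ℝ) (hc : ∀ v, 0 < c v)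

/-- **IUTchII:Cor4.5(ii)** (kurims p.132 l.19–37) «a functorial algorithm in the `D^⊢`-prime-strip `‡D^⊢` for constructing a Frobenioid
`D^⊩(‡D^⊢)` […] isomorphic to the Frobenioid “`C^⊩_mod`” […], equipped with a bijection `Prime(D^⊩(‡D^⊢)) ⥲ V̲` […] and, for each
`v ∈ V̲`, an isomorphism of topological monoids `‡ρ_{D^⊩,v} : Φ_{D^⊩(‡D^⊢),v} ⥲ R_{≥0}(‡D^⊢)_v`», as a FUNCTOR on any category `𝒟` of
`D^⊢`-prime-strips, from its object-level inputs: the pointed lines `R_{≥0}(X)_v ∋ log^{X}(p_v)` of each strip `X` (`line`;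
[AbsTopIII] Prop 5.8 (iii)/(vi), owner abc-iut-L4-t3) and the scalars of `ρ_{D^⊩,v}` (`c`, depending on `v` only; [IUTchI]
Ex 3.5 (iii), abc-iut-L5-t2 `rhoDScalar`/`logDPhiCoord`). The morphism part is FORCED (module docstring): degree `1` and
THE pointed isomorphisms `RLine.frobIso`. [cite: Mochizuki2012, Cor 4.5 (ii) p.132] -/
noncomputable def realifiedD : 𝒟 ⥤ RlfData.{u, w} V where
  obj X := ⟨line X, c, hc⟩
  map {X Y} _ :=
    { deg := 1
      deg_pos := one_pos
      lineIso := fun v => RLine.frobIso (line X v) (line Y v)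
      compat := fun v => by rw [map_smul, RLine.frobIso_frob, one_mul] }
  map_id X := RlfData.Hom.ext_of_deg_eq rfl
  map_comp f g := RlfData.Hom.ext_of_deg_eq (by simp)

/-- `D^⊩(X)` has the lines of `X`. [cite: Mochizuki2012, Cor 4.5 (ii) p.132] -/
@[simp] theorem realifiedD_obj_line (X : 𝒟) : ((realifiedD line c hc).obj X).line = line X := rfl

/-- `D^⊩(X)` has the (strip-independent) scalars `c`. [cite: Mochizuki2012, Cor 4.5 (ii) p.132] -/
@[simp] theorem realifiedD_obj_rhoCoeff (X : 𝒟) : ((realifiedD line c hc).obj X).rhoCoeff = c := rfl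

/-- `D^⊩(f)` has degree `1`. [cite: Mochizuki2012, Cor 4.5 (ii) p.132] -/
@[simp] theorem realifiedD_map_deg {X Y : 𝒟} (f : X ⟶ Y) : ((realifiedD line c hc).map f).deg = 1 := rfl

/-- `D^⊩(f)` is Frobenius-preserving at every `v` (`log^{†D^⊢}(p_v) ↦ log^{‡D^⊢}(p_v)`). [cite: Mochizuki2012, Cor 4.5 (ii) p.132] -/
theorem realifiedD_map_isFrobPreservingAt {X Y : 𝒟} (f : X ⟶ Y) (v : V) :
    ((realifiedD line c hc).map f).IsFrobPreservingAt v :=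
  RLine.frobIso_frob _ _

/-- **IUTchII:Cor4.10(v)** (kurims p.160 l.77–81 «The full poly-isomorphism `†D^⊢_△ ⥲ ‡D^⊢_△` […] induces […] an isomorphism of collections
of data») PARALLEL morphisms of `D^⊢`-prime-strips induce the SAME morphism of data. [cite: Mochizuki2012, Cor 4.10 (v) p.160] -/
theorem realifiedD_map_eq {X Y : 𝒟} (f g : X ⟶ Y) : (realifiedD line c hc).map f = (realifiedD line c hc).map g :=
  RlfData.Hom.ext_of_deg_eq rfl

/-- **IUTchII:Cor4.10(v)** (kurims p.160) `D^⊩(−)` sends every ENDOMORPHISM of a `D^⊢`-prime-strip to the identity.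
[cite: Mochizuki2012, Cor 4.10 (v) p.160] -/
theorem realifiedD_map_endo {X : 𝒟} (f : X ⟶ X) : (realifiedD line c hc).map f = 𝟙 _ := by
  rw [← (realifiedD line c hc).map_id]; exact realifiedD_map_eq line c hc f _

/-- **IUTchII:Cor4.10(v)** (kurims p.160) / **IUTchIII:Thm1.5(v)** (kurims p.50): `D^⊩(−)` KILLS EVERY AUTOMORPHISM of a
`D^⊢`-prime-strip — the statement GAP row G-w4d009-1 asks of a real `realified` (`B.realified.mapIso a = Iso.refl _`).
[cite: Mochizuki2012, Cor 4.10 (v) p.160] -/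
theorem realifiedD_mapIso_eq_refl {X : 𝒟} (a : X ≅ X) : (realifiedD line c hc).mapIso a = Iso.refl _ :=
  Iso.ext (realifiedD_map_endo line c hc a.hom)

/-- **IUTchII:Cor4.10(v)** (kurims p.160) parallel ISOMORPHISMS `α, β : †D^⊢ ⥲ ‡D^⊢` induce the same isomorphism of data («induces
AN isomorphism»). [cite: Mochizuki2012, Cor 4.10 (v) p.160] -/
theorem realifiedD_mapIso_eq {X Y : 𝒟} (a b : X ≅ Y) :
    (realifiedD line c hc).mapIso a = (realifiedD line c hc).mapIso b :=
  Iso.ext (realifiedD_map_eq line c hc a.hom b.hom)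

/-- **IUTchII:Cor4.10(v)** (kurims p.160 l.77–81) the FULL poly-isomorphism `†D^⊢ ⥲ ‡D^⊢` (any nonempty poly-isomorphism) induces the
SINGLE isomorphism `D^⊩(α)` of collections of data, for any constituent `α`. [cite: Mochizuki2012, Cor 4.10 (v) p.160] -/
theorem map_polyIso_eq_single {X Y : 𝒟} {P : PolyIso X Y} (α : X ≅ Y) (hα : α ∈ P) :
    P.map (realifiedD line c hc) = PolyIso.single ((realifiedD line c hc).mapIso α) := by
  ext e
  simp only [PolyIso.mem_map, PolyIso.single, Set.mem_singleton_iff]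
  constructor
  · rintro ⟨β, -, rfl⟩
    exact realifiedD_mapIso_eq line c hc β α
  · rintro rfl
    exact ⟨α, hα, rfl⟩

/-- **IUTchII:Cor4.10(v)** (kurims p.161 l.3–6) «compatible, relative to the Θ^{×μ}- and Θ^{×μ}_{gau}-links of (iii), with the `R_{>0}`-orbits
of the isomorphisms of collections of data» — at the level typed here: composing the `ℝ_{>0}`-orbit of a Kummer isomorphism
`κ : A ⥲ D^⊩(X)` (Cor 4.6 (ii)) with the induced isomorphism `D^⊩(α) : D^⊩(X) ⥲ D^⊩(Y)` gives the `ℝ_{>0}`-orbit of `κ ≫ D^⊩(α)`;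
both orbits are FULL poly-isomorphisms (`orbit_eq_full`), so the compatibility holds and is not vacuous.
[cite: Mochizuki2012, Cor 4.10 (v) p.161] -/
theorem orbit_comp_realifiedD {A : RlfData.{u, w} V} {X Y : 𝒟} (κ : A ≅ (realifiedD line c hc).obj X) (α : X ≅ Y) :
    (RlfData.orbit κ).comp (PolyIso.single ((realifiedD line c hc).mapIso α)) =
      RlfData.orbit (κ ≪≫ (realifiedD line c hc).mapIso α) := by
  rw [RlfData.orbit_eq_full, RlfData.orbit_eq_full]
  exact PolyIso.full_comp_of_nonempty ⟨_, rfl⟩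

end RealifiedD

end Literature.IUT.HodgeArakelov
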